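import Summits.Ventures.YMGap.RobustBall.BoundaryDecayPeriodised
import Summits.Ventures.YMGap.RobustBall.OneStateReflection
import Summits.Ventures.YMGap.RobustBall.PerturbedGaugeInvariance
import Summits.Ventures.YMGap.RobustBall.OneStateMasterRate
import Summits.Ventures.YMGap.RobustBall.CentreTubeLinkRows
import Summits.Ventures.YMGap.RobustBall.CentreBlindStarWindow
import HarnessLib

/-!
# Venture statement — YMGap (cell `pub-ymgap`) — CONJUNCT BODIES T62, T63, T65 (V22, block 3 of 4)

STATUS: FILED by p2 g12 as contingent filer under lead R299 (bus 2026-08-23T22:22:12Z) on the lead's V22 BOOKING line, quoted verbatim: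
«2026-08-23T23:50:48Z lead (g8) → ★ V22 BOOKING (R294/R299/R301; lead g8) → p2 (g12) [inject verbatim via mkcandidates.sh], referee (g30), p3 (g7),
writer (g12), rb-theory (g16) cc owners: `StatementConjunctsV22.lean` = block A dff4d65aabaff373 (372 l) (T55a–d·T55 rb-p2 FreeEnergyLaw; T56a–e·T56
ds-1 Pressure-A; T57a,b·T57 ds-3 part D) · `…V22B.lean` = block B 609b24d462b1cfbc (382 l) (T58a,b·T58; T59a,b·T59; T46a–c·T46; T60a,b·T60) ·
`…V22C.lean` = block C e081844ac208ac1b (342 l) (T62a–e·T62 ds-3 part B; T63 ds-3 part H; T65a,b·T65 ds-4 CentreTube) · `…V22D.lean` = block D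
a5d811943bcc1fdb (155 l; T61a–d·T61 ds-1 Pressure-B) «4 of 4»; numbered base A 6af97ec141cbb745 / B e6e71cdd58a392a0 / C bdd095e9b6ac86ce / D
701ed23113043693 (numbered monolith 61108ff1cf2b97b8; byte-compare 35/35); map v1 127e243484fe3a02 + addenda 2254c71f1c2725b3; FINAL SET = p2 l.4946
(re-probe 23:44–23:47Z: T65/T61 GREEN, T64 rc 75). Every conjunct restates BY NAME a theorem already ACCEPTED in the tree (statement-index
bookkeeping; finite lattice, strong/intermediate coupling; nothing continuum / OS / infinite-volume-limit-as-physics / mass gap / Clay). Filer p2 g12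
per R299 (p3 g7 does NOT claim; fallback only if no p2 INTENT/SUBMITTED by 00:30Z): `--kind definition`, ≤ 400 l/block, dry-runs, 00:10Z INTENT check,
file A → B → C → D, ONE «SUBMITTED» line with pids + filed sha16s + consolidating decl names per block; referee g30 legs on FILED bytes; lead books on
ACCEPT + commit. V23 = T64a–e·T64 (rb-p1, unbuilt parent at the re-probe; numbered-PENDING 9e47a244954cc2f4), T65c (ds-4), T66a–e (ds-3), T67a–d +
T68a (rb-p2 098236ae25992b7a); no T68b. RECORD: v1.11 `YMGapStatementV1_11` p368908 7bed0099cf4c OF RECORD (l.4883); v1.12 := v1.11 ∧ V22 ∧ V22B ∧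
V22C ∧ V22D by a later seat after V22* are built (p3 l.4789 (3), tools-p3/mkindex_next.py).».
Third of four V22 block files (block 1 = `StatementConjunctsV22.lean (T55, T56, T57)`; block 2 = `StatementConjunctsV22B.lean (T58, T59, T46, T60)`; block 4 = `StatementConjunctsV22D.lean (T61)`).  These owner sets turned GREEN
at the pre-stage refreshes of 2026-08-23 23:10–23:55Z (their parents' farm oleans built during the evening backlog drain).  Texts, VERBATIM from the owner files:
T62 (one state at a rate: thermodynamic-limit, torus and periodised finite-size rates, hyperoctahedral and gauge invariance; ds-3 g12 part B `HOME/ds/ds3/lean/g12/texts/V1XConjunctsDS3g12B.lean` 04326e63bdd87f05); T63 (the `SU(2)` Wilson one-state master rate, |β_W| ≤ 1/9; ds-3 g12 part H `…/V1XConjunctsDS3g12H.lean` 8098a3835ed25fa4; single text); T65a,b (the quantitative centre-tube area law on the ball and the centre-blind star window; ds-4 g9b `HOME/ds/ds4/lean/link/V1XConjunctsDS4g9b.lean` 3ebda2062e54ce3c).  Only decl names change (map of record `HOME/p2/v22-prestage/RENAMES-PROPOSAL.txt` 127e243484fe3a02, lead R294/R301); the consolidating conjunctions are the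
pre-stage defaults (one per owner file; single-text sets have none); built mechanically by `HOME/p2/v22-prestage/mkmono.py`; byte-compare `bytecmp.py --map` = verbatim-modulo-map.

HONEST FRAMING. WHAT THIS IS: bodies `Tk_… : Prop` + witnesses `Tk_…_holds`, kernel-checked with NO hypothesis, closing by TREE constants only. STRONG-COUPLING LATTICE
statements about `SU(2)` / `SU(N)` lattice Yang–Mills with the Wilson action and the typed perturbation balls (one-state rates and symmetries, thermodynamic identities at and
near β = 0, screening / truncation / centre-tube statements on the balls, as listed).  Every window, radius or rate is where a BOUND closes, not a transition.  WHAT THIS IS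
NOT: no sharp constants, nothing about the crossover, scaling, a continuum limit, confinement in the continuum, or the Yang–Mills Millennium problem.
-/

noncomputable section

namespace Summit.Ventures.YMGap

/-! ### OWNER FILE `ds/ds3/lean/g12/texts/V1XConjunctsDS3g12B.lean` (sha16 04326e63bdd87f05) — section `V22_ds3_PartB` -/
section V22_ds3_PartB

/-!
Statement v1.x candidate conjuncts from ds-3's gen-12 files, PART B (TEXT for the p3 seat; checkable once BoundaryDecayBox/KR/Torus,
OneStateReflection and PerturbedGaugeInvariance are IN THE TREE; NOT proposed by ds-3). Y2 ROBUST-BALL: thermodynamic-limit RATE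
along boxes uniformly in the boundary field; FINITE-SIZE EFFECT OF THE TORUS; the HYPEROCTAHEDRAL one state; GAUGE INVARIANCE of
every DLR state. HONEST LABEL: strong-coupling lattice statements inside the single-link (quarter) door for the rates; the
symmetry statements are lattice DLR bookkeeping; nothing continuum, nothing at the Y3 crossover couplings.
-/

open MeasureTheory Filter Topology
open scoped NNReal
open Literature.Probability.LatticeModels hiding configShift configShift_apply
open Literature.MathematicalPhysics.QuantumLattice (fundamentalRep ZdEdge LGConfig ymSpecification ymGibbsMeasures
  IsZdTranslationInvariant infiniteVolumeLimitPoints gaugeTransformZd IsZdGaugeInvariant toTorusObservable)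
open Literature.MathematicalPhysics.QuantumFieldTheory (IsLipschitzCylinder configPermZd wilsonExpectation)
open Summit.QuantumFields.GaugeBoot (configSiteReflect)
open Summit.Ventures.YMGap
open Summit.Ventures.YMGap.RobustBall

/-- **T62a_SU2WilsonThermodynamicLimitRate — `SU(2)` on `ℤ⁴`, the Wilson point through the quarter door**: for `0 ≤ β_W ≤ 1/9`,
EVERY DLR state `μ` (tree coupling `β_W/2`), every pair of box sizes `m, n`, EVERY boundary field `η` on the box `boxLinks 4 n` and
every Lipschitz cylinder `F` (constant `K`) on links `Δ ⊆ boxLinks 4 m`: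
`|∫ F dγ_{boxLinks 4 n}(·|η) − ∫ F dμ| ≤ 2√2 · K · #Δ · (1/2)^{n − m}`; for `1/9 ≤ β_W < 2/9` the ratio is `(9/2)β_W`
(`RobustBall.su2_wilson_box_upTo_oneNinth`, `su2_wilson_box_lt_twoNinths`, BoundaryDecayKR). -/
def T62a_SU2WilsonThermodynamicLimitRate : Prop :=
  (∀ βW : ℝ, 0 ≤ βW → βW ≤ 1 / 9 →
    ∀ μ ∈ ymGibbsMeasures (d := 4) (fundamentalRep (Fin 2)) (βW / 2), ∀ (m n : ℕ)
      (η : LGConfig 4 (Matrix.specialUnitaryGroup (Fin 2) ℂ)) (F : LGConfig 4 (Matrix.specialUnitaryGroup (Fin 2) ℂ) → ℝ)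
      (Δ : Finset (ZdEdge 4)) (K : ℝ≥0), IsLipschitzCylinder (fundamentalRep (Fin 2)) F Δ K → Δ ⊆ boxLinks 4 m →
      |(∫ U, F U ∂(ymSpecification (d := 4) (fundamentalRep (Fin 2)) (βW / 2) (boxLinks 4 n) η)) - ∫ U, F U ∂μ| ≤
        2 * Real.sqrt 2 * K * Δ.card * (1 / 2 : ℝ) ^ (n - m)) ∧
  (∀ βW : ℝ, 1 / 9 ≤ βW → βW < 2 / 9 →
    ∀ μ ∈ ymGibbsMeasures (d := 4) (fundamentalRep (Fin 2)) (βW / 2), ∀ (m n : ℕ)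
      (η : LGConfig 4 (Matrix.specialUnitaryGroup (Fin 2) ℂ)) (F : LGConfig 4 (Matrix.specialUnitaryGroup (Fin 2) ℂ) → ℝ)
      (Δ : Finset (ZdEdge 4)) (K : ℝ≥0), IsLipschitzCylinder (fundamentalRep (Fin 2)) F Δ K → Δ ⊆ boxLinks 4 m →
      |(∫ U, F U ∂(ymSpecification (d := 4) (fundamentalRep (Fin 2)) (βW / 2) (boxLinks 4 n) η)) - ∫ U, F U ∂μ| ≤
        2 * Real.sqrt 2 * K * Δ.card * (9 / 2 * βW) ^ (n - m))

/-- T62a_SU2WilsonThermodynamicLimitRate holds. -/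
theorem T62a_SU2WilsonThermodynamicLimitRate_holds : T62a_SU2WilsonThermodynamicLimitRate :=
  ⟨fun _ h0 h _ hμ _ n η _ _ _ hF hΔ => su2_wilson_box_upTo_oneNinth h0 h hμ n η hF hΔ,
    fun _ h0 h _ hμ _ n η _ _ _ hF hΔ => su2_wilson_box_lt_twoNinths h0 h hμ n η hF hΔ⟩

/-- **T62b_SU2WilsonTorusFiniteSize — FINITE-SIZE EFFECT OF THE TORUS, `SU(2)` on `ℤ⁴`**: for `0 ≤ β_W ≤ 1/9`, EVERY DLR state `μ`,
every `m ≤ n`, every torus side `L` with `2(n+1) < L` and every Lipschitz cylinder `F` (constant `K`) on links based in `[−m, m]⁴`: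
`|⟨F ∘ torusLift⟩_{(ℤ/L)⁴, β_W} − ∫ F dμ| ≤ 2√2 · K · #Δ · (1/2)^{n − m}` — the periodic finite-volume Wilson state is exponentially
close in the torus side to the infinite-volume state; for `1/9 ≤ β_W < 2/9` the ratio is `(9/2)β_W`; every `N ≥ 2` at 't Hooft
`|β| < 1/48`: ratio `max(ρ, ½)`, `ρ ≥ 18|β|/(1/2 − 6|β|)` (`RobustBall.su2_wilson_torus_upTo_oneNinth`, `su2_wilson_torus_lt_twoNinths`,
`suN_wilson_torus_dim4`, BoundaryDecayTorus). -/
def T62b_SU2WilsonTorusFiniteSize : Prop :=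
  (∀ βW : ℝ, 0 ≤ βW → βW ≤ 1 / 9 →
    ∀ μ ∈ ymGibbsMeasures (d := 4) (fundamentalRep (Fin 2)) (βW / 2), ∀ (m n L : ℕ) [NeZero L], m ≤ n → 2 * (n + 1) < L →
      ∀ (F : LGConfig 4 (Matrix.specialUnitaryGroup (Fin 2) ℂ) → ℝ) (Δ : Finset (ZdEdge 4)) (K : ℝ≥0),
      IsLipschitzCylinder (fundamentalRep (Fin 2)) F Δ K → Δ ⊆ boxLinks 4 m →
      |wilsonExpectation (fundamentalRep (Fin 2)) (βW / 2) (toTorusObservable L F) - ∫ U, F U ∂μ| ≤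
        2 * Real.sqrt 2 * K * Δ.card * (1 / 2 : ℝ) ^ (n - m)) ∧
  (∀ βW : ℝ, 1 / 9 ≤ βW → βW < 2 / 9 →
    ∀ μ ∈ ymGibbsMeasures (d := 4) (fundamentalRep (Fin 2)) (βW / 2), ∀ (m n L : ℕ) [NeZero L], m ≤ n → 2 * (n + 1) < L →
      ∀ (F : LGConfig 4 (Matrix.specialUnitaryGroup (Fin 2) ℂ) → ℝ) (Δ : Finset (ZdEdge 4)) (K : ℝ≥0),
      IsLipschitzCylinder (fundamentalRep (Fin 2)) F Δ K → Δ ⊆ boxLinks 4 m →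
      |wilsonExpectation (fundamentalRep (Fin 2)) (βW / 2) (toTorusObservable L F) - ∫ U, F U ∂μ| ≤
        2 * Real.sqrt 2 * K * Δ.card * (9 / 2 * βW) ^ (n - m)) ∧
  (∀ N : ℕ, 2 ≤ N → ∀ β ρ : ℝ, |β| < 1 / 48 → 18 * |β| / (1 / 2 - 6 * |β|) ≤ ρ → ρ < 1 →
    ∀ μ ∈ ymGibbsMeasures (d := 4) (fundamentalRep (Fin N)) (N * β), ∀ (m n L : ℕ) [NeZero L], m ≤ n → 2 * (n + 1) < L →
      ∀ (F : LGConfig 4 (Matrix.specialUnitaryGroup (Fin N) ℂ) → ℝ) (Δ : Finset (ZdEdge 4)) (K : ℝ≥0),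
      IsLipschitzCylinder (fundamentalRep (Fin N)) F Δ K → Δ ⊆ boxLinks 4 m →
      |wilsonExpectation (fundamentalRep (Fin N)) (N * β) (toTorusObservable L F) - ∫ U, F U ∂μ| ≤
        2 * Real.sqrt N * K * Δ.card * (max ρ (1 / 2)) ^ (n - m))

/-- T62b_SU2WilsonTorusFiniteSize holds. -/
theorem T62b_SU2WilsonTorusFiniteSize_holds : T62b_SU2WilsonTorusFiniteSize :=
  ⟨fun _ h0 h _ hμ _ _ _ _ hmn hL _ _ _ hF hΔ => su2_wilson_torus_upTo_oneNinth h0 h hμ hmn hL hF hΔ,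
    fun _ h0 h _ hμ _ _ _ _ hmn hL _ _ _ hF hΔ => su2_wilson_torus_lt_twoNinths h0 h hμ hmn hL hF hΔ,
    fun _ hN _ _ hβ hρ hρ1 _ hμ _ _ _ _ hmn hL _ _ _ hF hΔ => suN_wilson_torus_dim4 hN hβ hρ hρ1 hμ hmn hL hF hΔ⟩

/-- **T62c_WilsonOneStateHyperoctahedral — every `d ≥ 1`, `N`, `β` (Wilson)**: under `MassGapAt d N β` there is one probability measure
`μ` with `ymGibbsMeasures = {μ}` (unique DLR state) and `infiniteVolumeLimitPoints = {μ}` (the only torus limit), invariant under every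
lattice translation, every permutation of the axes and every axis reflection `x_i ↦ −x_i` (the gauge-boot cell's `configSiteReflect i`):
the one state carries the full hyperoctahedral space group of `ℤ^d` (`RobustBall.oneState_hyperoctahedral_of_massGapAt`; cells
`su2_wilson_oneState_hyperoctahedral` at every `|b| ≤ 9/50`, `suN_wilson_oneState_hyperoctahedral_sharp` at every 't Hooft `|β| < 1/(8d)`);
and the `SU(2)` Bhanot–Creutz mixed action at `β_W = 1/8`, `|t| ≤ 1/100` has one DLR state invariant under all four axis reflections
(`su2_mixedAction_oneState_reflectInvariant`, OneStateReflection). -/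
def T62c_WilsonOneStateHyperoctahedral : Prop :=
  (∀ (d N : ℕ) [NeZero d] (β : ℝ), MassGapAt d N β →
    ∃ μ : Measure (LGConfig d (Matrix.specialUnitaryGroup (Fin N) ℂ)),
      ymGibbsMeasures (d := d) (fundamentalRep (Fin N)) ((N : ℝ) * β) = {μ} ∧
      infiniteVolumeLimitPoints (d := d) (fundamentalRep (Fin N)) ((N : ℝ) * β) = {μ} ∧
      IsZdTranslationInvariant μ ∧ (∀ π : Equiv.Perm (Fin d), μ.map (configPermZd π) = μ) ∧
      ∀ i : Fin d, μ.map (configSiteReflect i) = μ) ∧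
  (∀ t : ℝ, |t| ≤ 1 / 100 → ∀ i : Fin 4,
    ∃ μ : Measure (LGConfig 4 (Matrix.specialUnitaryGroup (Fin 2) ℂ)),
      perturbedGibbsMeasures (d := 4) (fundamentalRep (Fin 2)) (((2 : ℕ) : ℝ) * ((1 / 8 : ℝ) / 4))
          (adjointWitness t) plaquetteSupp = {μ} ∧ μ.map (configSiteReflect i) = μ)

/-- T62c_WilsonOneStateHyperoctahedral holds. -/
theorem T62c_WilsonOneStateHyperoctahedral_holds : T62c_WilsonOneStateHyperoctahedral :=
  ⟨fun _ _ _ _ hgap => oneState_hyperoctahedral_of_massGapAt hgap,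
    fun _ ht i => su2_mixedAction_oneState_reflectInvariant ht i⟩

/-- **T62d_DLRGaugeInvariance — every compact metrisable group, continuous representation, coupling, dimension**: EVERY DLR state of
lattice Yang–Mills is gauge invariant, `μ ∘ (gaugeTransformZd g)⁻¹ = μ` for every `g : ℤ^d → G`, and so is EVERY DLR state of every
member of the perturbed families with gauge-invariant terms (tier 1 `perturbedGibbsMeasures`, tier 2 `perturbedGibbsMeasuresS`) — no
uniqueness, no door (`RobustBall.map_gaugeTransformZd_eq_of_mem_ymGibbsMeasures`, `map_gaugeTransformZd_eq_of_mem_perturbedGibbsMeasures`,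
`map_gaugeTransformZd_eq_of_mem_perturbedGibbsMeasuresS`, PerturbedGaugeInvariance). -/
def T62d_DLRGaugeInvariance : Prop :=
  ∀ (d N : ℕ) (G : Type) [Group G] [TopologicalSpace G] [IsTopologicalGroup G] [CompactSpace G] [MeasurableSpace G]
    [BorelSpace G] [SecondCountableTopology G] [T2Space G] (ρ : G →* Matrix (Fin N) (Fin N) ℂ) (β : ℝ),
    (∀ μ ∈ ymGibbsMeasures (d := d) ρ β, ∀ g : Site d → G, μ.map (gaugeTransformZd g) = μ) ∧
    (∀ (W : Potential (ZdEdge d) G) (supp : Finset (ZdEdge d) → Finset (Finset (ZdEdge d))),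
      (∀ X, IsZdGaugeInvariant (W X)) →
        ∀ μ ∈ perturbedGibbsMeasures (d := d) ρ β W supp, ∀ g : Site d → G, μ.map (gaugeTransformZd g) = μ) ∧
    (∀ W : Potential (ZdEdge d) G, (∀ X, IsZdGaugeInvariant (W X)) →
        ∀ μ ∈ perturbedGibbsMeasuresS (d := d) ρ β W, ∀ g : Site d → G, μ.map (gaugeTransformZd g) = μ)

/-- T62d_DLRGaugeInvariance holds. -/
theorem T62d_DLRGaugeInvariance_holds : T62d_DLRGaugeInvariance :=
  fun _ _ _ _ _ _ _ _ _ _ _ ρ β =>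
    ⟨fun _ hμ g => map_gaugeTransformZd_eq_of_mem_ymGibbsMeasures ρ β hμ g,
      fun _ supp hg _ hμ g => map_gaugeTransformZd_eq_of_mem_perturbedGibbsMeasures ρ β hg supp hμ g,
      fun _ hg _ hμ g => map_gaugeTransformZd_eq_of_mem_perturbedGibbsMeasuresS ρ β hg hμ g⟩

/-- **T62e_SU2PeriodisedTorusFiniteSize — finite-size effect of the torus for the MEMBERS of the `SU(2)` ball on `ℤ⁴`**: if
`6|β_W| e^{ε₀} + e^{ε₀/2} √(2/3) ε₁ ≤ ρ < 1` then for every member `(W, supp)` of `MemBallZd ε₀ ε₁ R` with gauge-invariant bounded terms, every DLR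
state `μ`, every Lipschitz cylinder `F` (constant `K`) on links `Δ ⊆ boxLinks 4 m`, `m ≤ n` and every `L` with `n + max(1,R) ≤ L/2`, the
PERIODISED torus state of side `L + 1` satisfies `|⟨F ∘ torusLift⟩^{W,per} − ∫ F dμ| ≤ 2√2 · K · #Δ · max(ρ,½)^{⌊(n − m)/max(1,R)⌋}`
(`RobustBall.su2_abs_periodised_sub_integral_le_dim4`, BoundaryDecayPeriodised; the quantitative Van Hove join). -/
def T62e_SU2PeriodisedTorusFiniteSize : Prop :=
  ∀ (βW ε₀ ε₁ ρ R : ℝ), 6 * |βW| * Real.exp ε₀ + Real.exp (ε₀ / 2) * Real.sqrt (2 / 3) * ε₁ ≤ ρ → ρ < 1 →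
    ∀ (W : Potential (ZdEdge 4) (Matrix.specialUnitaryGroup (Fin 2) ℂ)) (supp : Finset (ZdEdge 4) → Finset (Finset (ZdEdge 4)))
      (hmem : MemBallZd ε₀ ε₁ R W supp) (hg : ∀ X, IsZdGaugeInvariant (W X)) (hb : ∀ X, ∃ C, ∀ U, |W X U| ≤ C),
      ∀ μ ∈ perturbedGibbsMeasures (d := 4) (fundamentalRep (Fin 2)) ((2 : ℕ) * (βW / 4)) W supp,
      ∀ (m n L : ℕ), m ≤ n → (n : ℝ) + max 1 R ≤ (L / 2 : ℕ) →
        ∀ (F : LGConfig 4 (Matrix.specialUnitaryGroup (Fin 2) ℂ) → ℝ) (Δ : Finset (ZdEdge 4)) (K : ℝ≥0),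
        IsLipschitzCylinder (fundamentalRep (Fin 2)) F Δ K → Δ ⊆ boxLinks 4 m →
          |(periodisedFamily W supp hmem.dependsOn hg (fun X => (hmem.continuous X).measurable) hb L).expectation
              (fundamentalRep (Fin 2)) ((2 : ℕ) * (βW / 4)) (toTorusObservable (L + 1) F) - ∫ U, F U ∂μ| ≤
            2 * Real.sqrt 2 * K * Δ.card * (max ρ (1 / 2)) ^ ⌊((n : ℝ) - m) / max 1 R⌋₊

/-- T62e_SU2PeriodisedTorusFiniteSize holds. -/
theorem T62e_SU2PeriodisedTorusFiniteSize_holds : T62e_SU2PeriodisedTorusFiniteSize :=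
  fun _ _ _ _ _ hρ hρ1 _ _ hmem hg hb _ hμ _ _ _ hmn hL _ _ _ hF hΔ =>
    su2_abs_periodised_sub_integral_le_dim4 hρ hρ1 hmem hg hb hμ hmn hL hF hΔ

/-! ### Capstone text (imports `OneStateMasterRate.lean` when it is in the tree; kept as a comment until then)

`T63_SU2WilsonOneStateMasterRate : Prop := ∀ βW, 0 ≤ βW → βW ≤ 1/9 → <the five-clause conclusion of
RobustBall.su2_wilson_oneState_master_rate>`; holds by `su2_wilson_oneState_master_rate`. p3: take the theorem's type verbatim.
-/

end V22_ds3_PartB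

/-! ### OWNER FILE `ds/ds3/lean/g12/texts/V1XConjunctsDS3g12H.lean` (sha16 8098a3835ed25fa4) — section `V22_ds3_PartH` -/
section V22_ds3_PartH

/-!
Statement v1.x candidate conjuncts from ds-3's gen-12 files, PART H — THE CAPSTONE (TEXT for the p3 seat; checkable once `OneStateMasterRate.lean`
(p369020) is IN THE TREE; NOT proposed by ds-3). Y2 ROBUST-BALL: `SU(2)` lattice Yang–Mills on `ℤ⁴` at `|β_W| ≤ 1/9` (tree coupling `β_W/2`) —
ONE state, the full torus sequence converges to it, it is hyperoctahedrally symmetric and gauge invariant, and it is reached exponentially fast from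
every finite volume with any boundary field and from every torus. HONEST LABEL: strong-coupling LATTICE statement (uniqueness window `|β_W| ≤ 9/25`,
rate window `β_W < 2/9`); Dobrushin-comparison lower bounds on the rates; nothing about the continuum limit or the Clay Millennium problem.
-/

open MeasureTheory Filter Topology
open scoped NNReal
open Literature.Probability.LatticeModels hiding configShift configShift_apply
open Literature.MathematicalPhysics.QuantumLattice
open Literature.MathematicalPhysics.QuantumFieldTheory hiding ZdEdge Site IsInfiniteVolumeLimit
open Summit.QuantumFields.GaugeBoot (configSiteReflect)
open Summit.Ventures.YMGap
open Summit.Ventures.YMGap.RobustBall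

/-- **T63_SU2WilsonOneStateMasterRate — `SU(2)` LATTICE YANG–MILLS ON `ℤ⁴` AT `|β_W| ≤ 1/9`** (tree coupling `β_W/2`): there is ONE probability
measure `μ` with (1) `ymGibbsMeasures = {μ}`, `infiniteVolumeLimitPoints = {μ}`, and `IsInfiniteVolumeLimit … μ` (the full sequence of torus
states converges to `μ` on every bounded continuous cylinder observable); (2) `μ` is invariant under every lattice translation, every permutation of
the axes and every axis reflection; (3) `μ` is invariant under every lattice gauge transformation; (4) for every box `[−n,n]⁴`, EVERY boundary field
and every Lipschitz cylinder `F` (constant `K`) on links based in `[−m,m]⁴`: `|∫ F dγ_{box n}(·|η) − ∫ F dμ| ≤ 2√2·K·#Δ·2^{−(n−m)}`; (5) for every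
torus side `L > 2(n+1)`, `m ≤ n`: `|⟨F ∘ torusLift⟩_{(ℤ/L)⁴} − ∫ F dμ| ≤ 2√2·K·#Δ·2^{−(n−m)}` (`RobustBall.su2_wilson_oneState_master_rate`). -/
def T63_SU2WilsonOneStateMasterRate : Prop :=
  ∀ βW : ℝ, |βW| ≤ 1 / 9 →
    ∃ μ : Measure (LGConfig 4 (Matrix.specialUnitaryGroup (Fin 2) ℂ)),
      ymGibbsMeasures (d := 4) (fundamentalRep (Fin 2)) (βW / 2) = {μ} ∧
      infiniteVolumeLimitPoints (d := 4) (fundamentalRep (Fin 2)) (βW / 2) = {μ} ∧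
      Literature.MathematicalPhysics.QuantumLattice.IsInfiniteVolumeLimit (d := 4) (fundamentalRep (Fin 2)) (βW / 2) μ ∧
      (IsZdTranslationInvariant μ ∧ (∀ π : Equiv.Perm (Fin 4), μ.map (configPermZd π) = μ) ∧
        ∀ i : Fin 4, μ.map (configSiteReflect i) = μ) ∧
      (∀ g : Site 4 → Matrix.specialUnitaryGroup (Fin 2) ℂ, μ.map (gaugeTransformZd g) = μ) ∧
      (∀ (m n : ℕ) (η : LGConfig 4 (Matrix.specialUnitaryGroup (Fin 2) ℂ)) (F : LGConfig 4 (Matrix.specialUnitaryGroup (Fin 2) ℂ) → ℝ)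
        (Δ : Finset (ZdEdge 4)) (K : ℝ≥0),
        IsLipschitzCylinder (fundamentalRep (Fin 2)) F Δ K → Δ ⊆ boxLinks 4 m →
          |(∫ U, F U ∂(ymSpecification (d := 4) (fundamentalRep (Fin 2)) (βW / 2) (boxLinks 4 n) η)) - ∫ U, F U ∂μ| ≤
            2 * Real.sqrt 2 * K * Δ.card * (1 / 2 : ℝ) ^ (n - m)) ∧
      (∀ (m n L : ℕ) [NeZero L], m ≤ n → 2 * (n + 1) < L →
        ∀ (F : LGConfig 4 (Matrix.specialUnitaryGroup (Fin 2) ℂ) → ℝ) (Δ : Finset (ZdEdge 4)) (K : ℝ≥0),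
        IsLipschitzCylinder (fundamentalRep (Fin 2)) F Δ K → Δ ⊆ boxLinks 4 m →
          |wilsonExpectation (fundamentalRep (Fin 2)) (βW / 2) (toTorusObservable L F) - ∫ U, F U ∂μ| ≤
            2 * Real.sqrt 2 * K * Δ.card * (1 / 2 : ℝ) ^ (n - m))

/-- T63_SU2WilsonOneStateMasterRate holds. -/
theorem T63_SU2WilsonOneStateMasterRate_holds : T63_SU2WilsonOneStateMasterRate :=
  fun _ h => su2_wilson_oneState_master_rate h

end V22_ds3_PartH

/-! ### OWNER FILE `ds/ds4/lean/link/V1XConjunctsDS4g9b.lean` (sha16 3ebda2062e54ce3c) — section `V22_ds4_CentreTube` -/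
section V22_ds4_CentreTube

/-!
Statement v1.x candidate conjuncts from ds-4's gen-9 files (TEXT for the p3 seat — V21 candidates; checkable against the tree once
`RobustBall/CentreTubeLink`, `RobustBall/CentreTubeLinkRows` and `RobustBall/CentreBlindStarWindow` are IN THE TREE with commits; NOT proposed by
ds-4).  TWO conjuncts: `T65a_CentreTubeQuantitative` (object 1) and `T65b_CentreBlindStar` (object 2).  Numbering is
p3's / the lead's.  Y2 ROBUST-BALL: THE QUANTITATIVE CENTRE TUBE — the countersigned currency `AreaLawCentreTubeFR N d β ε₀ ε₁ r` (T43 (i)) under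
the hypothesis `2(d−1)N|β| + √N ε₁ < 1` (the Lipschitz radius of the tier-1 ball; NO counting constant; every range `r`, every `ε₀`), its SU(2)
`d = 4` cell `(β_W, ε₁) = (1/8, 1/6)`, and the limit-state (string-tension) reading of that cell.  Relation to T43: T43 (i)/(ii) prove the same
currency under `2(d−1)N|β| + K(d,r) ε₀ < 1`, `K(4,1) = 2 449 020`; this conjunct neither replaces nor contradicts them (union of hypotheses).
OWNER COUNTERSIGN (ds-4 g9): these bytes are the text of record from this seat; p3 may rename / renumber / fold the opens, bodies unchanged.
-/


section T43Qsec

open MeasureTheory Filter Topology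
open Literature.MathematicalPhysics.QuantumLattice
open Literature.MathematicalPhysics.QuantumFieldTheory hiding ZdEdge Site
open Literature.Barriers.QuantumFields (suFundStringTension)
open Summit.Ventures.YMGap.RobustBall

/-- **T65a_CentreTubeQuantitative — track Y2 (seat ds-4 g9): THE TIER-1 BALL AROUND EVERY CENTRE-BLIND ACTION KEEPS THE AREA LAW ON A RADIUS OF
TIER-1 SIZE** — (i) for every `N ≥ 2`, every `d`, `r`, `ε₀` and every `β, ε₁` with `2(d−1)N|β| + √N ε₁ < 1`: `AreaLawCentreTubeFR N d β ε₀ ε₁ r`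
(ONE `(C, c)` for all tori, every twist-blind `W_b`, every `W ∈ ClusterDomainFR ε₀ ε₁ r`; `RobustBall.areaLawCentreTubeFR_of_lip`; mechanism: the
twist defect of a polymer activity reads the twist through the LINKS of the polymer and moves by `≤ 2√N Lip_e` per link, so the `ℤ_N`-layer
Dobrushin rows are `√N ×` the cross-Lipschitz load — no counting constant); (ii) CELL `SU(2)`, `d = 4`, `(β_W, ε₁) = (1/8, 1/6)`:
`AreaLawCentreTubeFR 2 4 (1/16) ε₀ (1/6) r` for every `ε₀`, `r` (`RobustBall.su2_areaLawCentreTubeFR_lip_cell_oneEighth`; `6 β_W + √2 ε₁ < 1`);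
(iii) LIMIT STATES OF THE CELL: one `c > 0` (and `C`) such that every infinite-volume limit state of every family eventually of the form `W_b + W`
(`W_b` twist-blind, `W ∈ ClusterDomainFR ε₀ (1/6) r`) at `β = 1/16` obeys `HasAreaLawWith μ χ₂ C c` and `c ≤ suFundStringTension 2 μ` WHENEVER the
string tension exists (`RobustBall.su2_stringTension_centreTubeFR_lip_cell_oneEighth`).  HONEST LABEL: strong-coupling LATTICE inequality (centre
dominance + `ℤ_N`-layer area law); the `β`-WINDOW `2(d−1)N|β| < 1` is the `ℤ_N`-layer window (smaller than tier 1's) and is NOT moved — only the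
radius; fundamental (nonzero-`N`-ality) loops; `σ`-EXISTENCE for non-Wilson members NOT claimed; rate a door artefact; T15's unbounded-range loop
terms outside; nothing continuum / spectral / Clay.  Texts: seat ds-4 (g9). -/
def T65a_CentreTubeQuantitative : Prop :=
  (∀ (N d : ℕ) [NeZero N], 2 ≤ N → ∀ (β ε₀ ε₁ : ℝ) (r : ℕ),
      2 * ((d - 1 : ℕ) : ℝ) * |β| * N + Real.sqrt N * ε₁ < 1 → AreaLawCentreTubeFR N d β ε₀ ε₁ r) ∧
  (∀ (ε₀ : ℝ) (r : ℕ), AreaLawCentreTubeFR 2 4 (1 / 16) ε₀ (1 / 6) r) ∧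
  (∀ (ε₀ : ℝ) (r : ℕ), ∃ C c : ℝ, 0 < c ∧ ∀ 𝓦 : PerturbationFamily 4 2,
      (∀ᶠ L : ℕ in atTop, ∃ Wb W : Perturbation 4 (L + 1) 2,
        IsTwistBlind Wb ∧ W ∈ ClusterDomainFR ε₀ (1 / 6 : ℝ) r ∧ 𝓦 L = Wb + W) →
        ∀ μ ∈ perturbedLimitPoints (1 / 16 : ℝ) 𝓦,
          HasAreaLawWith μ (fun g => normalisedCharacter 2 (fundamentalRep (Fin 2) g)) C c ∧
          ((∃ σ : ℝ, HasStringTension μ (fun g => normalisedCharacter 2 (fundamentalRep (Fin 2) g)) σ) →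
            c ≤ suFundStringTension 2 μ))

/-- T65a_CentreTubeQuantitative holds (`RobustBall.areaLawCentreTubeFR_of_lip`, `RobustBall.su2_areaLawCentreTubeFR_lip_cell_oneEighth`,
`RobustBall.su2_stringTension_centreTubeFR_lip_cell_oneEighth`; seat ds-4 g9 text). -/
theorem T65a_CentreTubeQuantitative_holds : T65a_CentreTubeQuantitative :=
  ⟨fun _ _ _ hN _ ε₀ _ r hβ => areaLawCentreTubeFR_of_lip hN ε₀ r hβ,
    fun ε₀ r => su2_areaLawCentreTubeFR_lip_cell_oneEighth ε₀ r,
    fun ε₀ r => su2_stringTension_centreTubeFR_lip_cell_oneEighth ε₀ r⟩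

end T43Qsec

section T43Ssec

open Summit.Ventures.YMGap.RobustBall

/-- **T65b_CentreBlindStar — track Y2 (seat ds-4 g9): THE STAR WINDOW FOR THE CENTRE-BLIND CLASS** — (i) `SU(2)`, every `d`: whenever
`2(d−1)(2(d−1)−1) · tanh²(2|β|) < 1` (`β = β_W/2` the tree coupling), `AreaLawCentreBlind 2 d β` — Wilson's area law `|⟨W_{R×T}⟩_{β,W,L}| ≤
C^{2(R+T)} e^{−cRT}` with ONE `(C, c)` on every torus for EVERY linkwise centre-blind perturbation `W` (any size / range: adjoint, mixed
fundamental–adjoint actions of any strength, …) (`RobustBall.su2_areaLawCentreBlind_star`; gen 7's T13C had the window `2(d−1)·2|β| < 1`);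
(ii) `d = 4`: `30 tanh²(2|β|) < 1 → AreaLawCentreBlind 2 4 β` and the CELL `AreaLawCentreBlind 2 4 (23/250)` (`β_W = 0.184 > 1/6`; the window ends at `0.18463…`); (iii) `d = 3`:
`12 tanh²(2|β|) < 1 → AreaLawCentreBlind 2 3 β` and the CELL `AreaLawCentreBlind 2 3 (7/50)` (`β_W = 0.28 > 1/4`).  MECHANISM: the centre-projected
`ℤ₂` layer is an Ising model with adversarial couplings `|J| ≤ β_W` on the triangle-free layer graph; Griffiths' signed-coupling comparison +
the Simon–Lieb inequality with STARS (random-current proof of Duminil-Copin–Tassion's Lemma 2.7 in the tree) give decay beyond the single-site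
Dobrushin radius.  HONEST LABEL: `SU(2)` only; centre-blind class only (no tube); `d = 4` window `tanh β_W < 1/√30` (`β_W < 0.18463`), far from the
`ℤ₂`-gauge transition `≈ 0.44` where the class deconfines; rate a door artefact; strong-coupling lattice statement; nothing continuum / spectral /
Clay.  Texts: seat ds-4 (g9). -/
def T65b_CentreBlindStar : Prop :=
  (∀ (d : ℕ) (β : ℝ), layerStarRate d β < 1 → AreaLawCentreBlind 2 d β) ∧
  ((∀ β : ℝ, 30 * Real.tanh (2 * |β|) ^ 2 < 1 → AreaLawCentreBlind 2 4 β) ∧ AreaLawCentreBlind 2 4 (23 / 250)) ∧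
  ((∀ β : ℝ, 12 * Real.tanh (2 * |β|) ^ 2 < 1 → AreaLawCentreBlind 2 3 β) ∧ AreaLawCentreBlind 2 3 (7 / 50))

/-- T65b_CentreBlindStar holds (`RobustBall.su2_areaLawCentreBlind_star`, `…_dim4`, `…_cell_sharp`, `…_dim3`, `…_cell_dim3`; seat ds-4 g9 text). -/
theorem T65b_CentreBlindStar_holds : T65b_CentreBlindStar :=
  ⟨fun _ _ h => su2_areaLawCentreBlind_star h,
    ⟨fun _ h => su2_areaLawCentreBlind_star_dim4 h, su2_areaLawCentreBlind_star_cell_sharp⟩,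
    ⟨fun _ h => su2_areaLawCentreBlind_star_dim3 h, su2_areaLawCentreBlind_star_cell_dim3⟩⟩

end T43Ssec

end V22_ds4_CentreTube

/-! ### DEFAULT GROUPING (p2): one consolidating conjunction per owner file — `G_<tag> := T_a ∧ T_b ∧ …` + `_holds`.
The lead composes V22 by theme; p3 renames `G_<tag> ↦ T<k>_<Name>` (via --map) or regroups at will; these are additions, not owner bytes. -/
section V22_groups_C

/-- Default group for section `V22_ds3_PartB`: the conjunction of its 5 owner texts. -/
def T62_TorusFiniteSizeAndInvariance : Prop :=
  T62a_SU2WilsonThermodynamicLimitRate ∧ T62b_SU2WilsonTorusFiniteSize ∧ T62c_WilsonOneStateHyperoctahedral ∧ T62d_DLRGaugeInvariance ∧ T62e_SU2PeriodisedTorusFiniteSize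

/-- `T62_TorusFiniteSizeAndInvariance` holds (componentwise by the owners' `_holds`). -/
theorem T62_TorusFiniteSizeAndInvariance_holds : T62_TorusFiniteSizeAndInvariance :=
  ⟨T62a_SU2WilsonThermodynamicLimitRate_holds, T62b_SU2WilsonTorusFiniteSize_holds, T62c_WilsonOneStateHyperoctahedral_holds, T62d_DLRGaugeInvariance_holds, T62e_SU2PeriodisedTorusFiniteSize_holds⟩

/-- Default group for section `V22_ds4_CentreTube`: the conjunction of its 2 owner texts. -/
def T65_CentreTubeQuantitative : Prop :=
  T65a_CentreTubeQuantitative ∧ T65b_CentreBlindStar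

/-- `T65_CentreTubeQuantitative` holds (componentwise by the owners' `_holds`). -/
theorem T65_CentreTubeQuantitative_holds : T65_CentreTubeQuantitative :=
  ⟨T65a_CentreTubeQuantitative_holds, T65b_CentreBlindStar_holds⟩

end V22_groups_C

end Summit.Ventures.YMGap

end
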